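import Summits.KontsevichZagierPeriods.KontsevichZagierPeriods.Theorems.IsogenyCertificatesXMapKernelCellsUnconditional
import Summits.KontsevichZagierPeriods.KontsevichZagierPeriods.Theorems.VolumeFormOffPlane.Negative.Core

/-!
# Stub-ideation k3 (FAMILY 3 — probe the extremes), companion sketch for
`STUB-IDEAS-stub_reductionToRealPeriodSector-3.md` — crux `XMapKernel` (stmt-KontsevichZagierPeriods-10663),
line `isogeny-orbit-collapse`, stub `K := stub_reductionToRealPeriodSector`.

Typed helper lemmas of the three plans (HA*, HB*, HC*). Everything named `…_holds`/without `sorry` below is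
PROVED here from tree theorems; the `sorry`s mark the one-prover-cycle helpers proposed in the plan (this is an
ideation scratch file under `Cruxes/…`, not a `Theorems/` landing). No statement of the tree is touched.
-/

noncomputable section

set_option linter.dupNamespace false

namespace Summit.KontsevichZagierPeriods.KontsevichZagierPeriods.Cruxes.XMapKernel.StubIdeasK3

open Literature.NumberTheory.Transcendental
open Summit.KontsevichZagierPeriods.XMapKernel.Negative (gens closure_gens_le_ker_eval)
open Summit.KontsevichZagierPeriods.SymplecticScissors.VolumeFormOffPlaneNegative
open Set MeasureTheory

/-! ## The stub, abstracted over its sector -/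

/-- The stub's sector generators: `[{x³+Ax+B>0}, a/√(x³+Ax+B)]`, `a ∈ ℚ` (verbatim from the signature). -/
def realSectorGens : Set KZ.FormalRep :=
  {d : KZ.FormalRep | ∃ (A B : ℤ) (a : ℚ) (r : KZ.IntegralRep 1), 4 * A ^ 3 + 27 * B ^ 2 ≠ 0 ∧
    r.domain = {x | 0 < x 0 ^ 3 + (A : ℝ) * x 0 + (B : ℝ)} ∧
    Set.EqOn r.integrand (fun x => (a : ℝ) / Real.sqrt (x 0 ^ 3 + (A : ℝ) * x 0 + (B : ℝ))) r.domain ∧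
    d = KZ.of r}

/-- Reduction of every kernel element to a sector `S` modulo `closure gens`. -/
def ReducesTo (S : AddSubgroup KZ.FormalRep) : Prop :=
  ∀ c : KZ.FormalRep, KZ.eval c = 0 → ∃ c' ∈ S, c - c' ∈ AddSubgroup.closure gens

/-- The cell of a sector `S`: kernel elements of `S` are already in `closure gens`. -/
def CellKernel (S : AddSubgroup KZ.FormalRep) : Prop :=
  ∀ c ∈ S, KZ.eval c = 0 → c ∈ AddSubgroup.closure gens

/-- The stub verbatim. -/
def StubK : Prop :=
  ∀ c : Literature.NumberTheory.Transcendental.KZ.FormalRep, Literature.NumberTheory.Transcendental.KZ.eval c = 0 → ∃ c' ∈ AddSubgroup.closure {d : Literature.NumberTheory.Transcendental.KZ.FormalRep | ∃ (A B : ℤ) (a : ℚ) (r : Literature.NumberTheory.Transcendental.KZ.IntegralRep 1), 4 * A ^ 3 + 27 * B ^ 2 ≠ 0 ∧ r.domain = {x | 0 < x 0 ^ 3 + (A : ℝ) * x 0 + (B : ℝ)} ∧ Set.EqOn r.integrand (fun x => (a : ℝ) / Real.sqrt (x 0 ^ 3 + (A : ℝ) * x 0 + (B : ℝ))) r.domain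 ∧ d = Literature.NumberTheory.Transcendental.KZ.of r}, c - c' ∈ AddSubgroup.closure Summit.KontsevichZagierPeriods.XMapKernel.Negative.gens

/-- The stub IS `ReducesTo (closure realSectorGens)` (definitional). -/
theorem stubK_iff_reducesTo : StubK ↔ ReducesTo (AddSubgroup.closure realSectorGens) := Iff.rfl

/-- Tree: the stub ↔ the summit, unconditionally (`XMapKernelCells.reductionToRealPeriodSector_iff_summit_holds`). -/
theorem stubK_iff_summit : StubK ↔ _root_.KontsevichZagierPeriods :=
  Summit.KontsevichZagierPeriods.IsogenyCertificates.XMapKernelCells.reductionToRealPeriodSector_iff_summit_holds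

/-! ## PLAN A — minimal counterexample ⇒ volume normal form; first open extreme = dimension 3 -/

/-- One slice of the volume frame (integrand-`1` representations of one dimension `N`). -/
def Slice (N : ℕ) : Prop :=
  ∀ (r r' : KZ.IntegralRep N), (∀ x ∈ r.domain, r.integrand x = 1) → (∀ x ∈ r'.domain, r'.integrand x = 1) →
    r.value = r'.value → KZ.Equivalent r r'

/-- The volume frame (= route item `VolumeForm`, stmt-3814, all `N`). -/
def VolumeFrame : Prop := ∀ N, Slice N

/-- **HA1 (XS, PROVED here)**: the stub is the shared volume frame `VolumeForm` (stmt-3814) — by name, through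
`stubK_iff_summit`, `offPlane_iff_summit`, `offPlane_iff_frame`. -/
theorem HA1_stubK_iff_volumeFrame : StubK ↔ VolumeFrame := by
  rw [stubK_iff_summit, ← offPlane_iff_summit, offPlane_iff_frame]
  rfl

/-- **HA1′ (PROVED)**: the slab ladder — failing dimensions are an up-set. -/
theorem HA1'_slice_mono {N : ℕ} (h : Slice (N + 1)) : Slice N :=
  fun r r' hr hr' hv => slice_of_slice_succ h r r' hr hr' hv

/-- **HA2 (XS, PROVED here)**: WHERE A COUNTEREXAMPLE TO THE STUB LIVES — a same-dimension pair of compact-volume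
type in some dimension `N ≥ 3` (minimal-counterexample normal form; `exists_ge_three_of_not_offPlane`). -/
theorem HA2_counterexample_normal_form (h : ¬ StubK) :
    ∃ N, 3 ≤ N ∧ ∃ r r' : KZ.IntegralRep N, (∀ x ∈ r.domain, r.integrand x = 1) ∧
      (∀ x ∈ r'.domain, r'.integrand x = 1) ∧ r.value = r'.value ∧ ¬ KZ.Equivalent r r' := by
  apply exists_ge_three_of_not_offPlane
  rwa [offPlane_iff_summit, ← stubK_iff_summit]

/-- **The first open extreme (NOT one cycle; recorded, not assigned)**: the slice `N = 3` alone — volumes of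
compact `ℚ`-semialgebraic solids, i.e. Conjecture 1 for 2-dimensional integrands. Strictly BELOW the stub
(`sliceThree_of_stubK`); the converse is not expected (no dimension descent inside the calculus). -/
def SliceThree : Prop := Slice 3

theorem sliceThree_of_stubK (h : StubK) : SliceThree := (HA1_stubK_iff_volumeFrame.mp h) 3

/-! ## PLAN B — perturb the proved cell to the Huber–Wüstholz-maximal linear sector -/

/-- Egg `(ω, η)`-sector generators (verbatim the sector of the landed `etaCellKernel_holds`). -/
def eggSectorGens : Set KZ.FormalRep :=
  {d : KZ.FormalRep | ∃ (A B : ℤ) (a₀ a₁ : ℚ) (r : KZ.IntegralRep 1), 4 * A ^ 3 + 27 * B ^ 2 < 0 ∧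
    r.domain = {x | x 0 ∈ {y : ℝ | 0 < y ^ 3 + (A : ℝ) * y + (B : ℝ)} \
      connectedComponentIn {y : ℝ | 0 < y ^ 3 + (A : ℝ) * y + (B : ℝ)} (1 + |(A : ℝ)| + |(B : ℝ)|)} ∧
    EqOn r.integrand (fun x => ((a₀ : ℝ) + (a₁ : ℝ) * x 0) / Real.sqrt (x 0 ^ 3 + (A : ℝ) * x 0 + (B : ℝ))) r.domain ∧
    d = KZ.of r}

/-- `π`-sector generators: `[{x² < 1}, a/√(1 − x²)]`, `a ∈ ℚ` (value `aπ`). -/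
def piSectorGens : Set KZ.FormalRep :=
  {d : KZ.FormalRep | ∃ (a : ℚ) (r : KZ.IntegralRep 1), r.domain = {x | x 0 ^ 2 < 1} ∧
    EqOn r.integrand (fun x => (a : ℝ) / Real.sqrt (1 - x 0 ^ 2)) r.domain ∧ d = KZ.of r}

/-- Constant generators: the dimension-`0` representations with a RATIONAL value. -/
def constGens : Set KZ.FormalRep :=
  {d : KZ.FormalRep | ∃ (a : ℚ) (r : KZ.IntegralRep 0), r.integrand default = (a : ℝ) ∧ d = KZ.of r}

/-- The HW-maximal linear sector the tree's transcendence theorem supports. -/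
def hwMaxGens : Set KZ.FormalRep := realSectorGens ∪ eggSectorGens ∪ piSectorGens ∪ constGens

/-- **HB1 (M, one cycle — numbers only)**: joint `ℚ`-independence structure of `1, π`, the full real periods
`Ω(A,B)`, and the egg periods / egg quasi-periods, for pairwise x-rationally non-isogenous nonsingular integral
cubics: a vanishing rational combination has zero constant and zero `π`-coefficient, and vanishes curve by curve.
From `HuberWustholzManyCurvePeriods_holds` (`α = u`, `β = v/(2i)`), the landed `stub_unboundedToEgg`
(egg = rational multiple of the unbounded integral, same curve) and Masser CM (`masser_ellipticPeriods_cm_holds`).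
Pattern: `XMapKernelCells.realPeriodIndependence_holds` / `etaIndependence_holds`. -/
theorem HB1_hwMaxIndependence : ∀ (k : ℕ) (A B : Fin k → ℤ) (u v : ℚ) (p e q : Fin k → ℚ),
    (∀ i, 4 * A i ^ 3 + 27 * B i ^ 2 ≠ 0) →
    (∀ i, ¬ 4 * A i ^ 3 + 27 * B i ^ 2 < 0 → e i = 0 ∧ q i = 0) →
    (∀ i j, i ≠ j → ¬ ∃ (f g : Polynomial ℚ) (c : ℚ), Polynomial.derivative f * g - f * Polynomial.derivative g ≠ 0 ∧
      Polynomial.C (c ^ 2) * g * (f ^ 3 + Polynomial.C (A j : ℚ) * f * g ^ 2 + Polynomial.C (B j : ℚ) * g ^ 3) =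
        (Polynomial.X ^ 3 + Polynomial.C (A i : ℚ) * Polynomial.X + Polynomial.C (B i : ℚ)) *
          (Polynomial.derivative f * g - f * Polynomial.derivative g) ^ 2) →
    (u : ℝ) + (v : ℝ) * Real.pi + ∑ i, ((p i : ℝ) * (∫ x in {x : Fin 1 → ℝ | 0 < x 0 ^ 3 + (A i : ℝ) * x 0 + (B i : ℝ)},
        1 / Real.sqrt (x 0 ^ 3 + (A i : ℝ) * x 0 + (B i : ℝ))) +
      (e i : ℝ) * (∫ x in {x : Fin 1 → ℝ | x 0 ∈ {y : ℝ | 0 < y ^ 3 + (A i : ℝ) * y + (B i : ℝ)} \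
        connectedComponentIn {y : ℝ | 0 < y ^ 3 + (A i : ℝ) * y + (B i : ℝ)} (1 + |(A i : ℝ)| + |(B i : ℝ)|)},
        1 / Real.sqrt (x 0 ^ 3 + (A i : ℝ) * x 0 + (B i : ℝ))) +
      (q i : ℝ) * (∫ x in {x : Fin 1 → ℝ | x 0 ∈ {y : ℝ | 0 < y ^ 3 + (A i : ℝ) * y + (B i : ℝ)} \
        connectedComponentIn {y : ℝ | 0 < y ^ 3 + (A i : ℝ) * y + (B i : ℝ)} (1 + |(A i : ℝ)| + |(B i : ℝ)|)},
        x 0 / Real.sqrt (x 0 ^ 3 + (A i : ℝ) * x 0 + (B i : ℝ)))) = 0 →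
    u = 0 ∧ v = 0 ∧ ∀ i, (p i : ℝ) * (∫ x in {x : Fin 1 → ℝ | 0 < x 0 ^ 3 + (A i : ℝ) * x 0 + (B i : ℝ)},
        1 / Real.sqrt (x 0 ^ 3 + (A i : ℝ) * x 0 + (B i : ℝ))) +
      (e i : ℝ) * (∫ x in {x : Fin 1 → ℝ | x 0 ∈ {y : ℝ | 0 < y ^ 3 + (A i : ℝ) * y + (B i : ℝ)} \
        connectedComponentIn {y : ℝ | 0 < y ^ 3 + (A i : ℝ) * y + (B i : ℝ)} (1 + |(A i : ℝ)| + |(B i : ℝ)|)},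
        1 / Real.sqrt (x 0 ^ 3 + (A i : ℝ) * x 0 + (B i : ℝ))) +
      (q i : ℝ) * (∫ x in {x : Fin 1 → ℝ | x 0 ∈ {y : ℝ | 0 < y ^ 3 + (A i : ℝ) * y + (B i : ℝ)} \
        connectedComponentIn {y : ℝ | 0 < y ^ 3 + (A i : ℝ) * y + (B i : ℝ)} (1 + |(A i : ℝ)| + |(B i : ℝ)|)},
        x 0 / Real.sqrt (x 0 ^ 3 + (A i : ℝ) * x 0 + (B i : ℝ))) = 0 ∧ q i = 0 := by
  sorry

/-- **HB2 (M, one cycle — formal)**: the HW-maximal linear CELL: kernel elements of the joint sector lie in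
`closure gens`. Glue of the landed cells `realPeriodCellKernel_holds`, `etaCellKernel_holds`, the landed bridge
`stub_unboundedToEgg`, the (1b)-collapse pattern of `stub_cellCollapse` for the `π`- and constant blocks, and HB1
for the cross terms. -/
theorem HB2_hwMaxCell : CellKernel (AddSubgroup.closure hwMaxGens) := by
  sorry

/-- **Glue (PROVED)**: a cell on ANY bigger sector `T` turns reduction-to-`T` into the stub (take `c' = 0`). -/
theorem reducesTo_of_reducesTo_of_cell (S T : AddSubgroup KZ.FormalRep) (hT : CellKernel T)
    (h : ReducesTo T) : ReducesTo S := by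
  intro c hc
  obtain ⟨c'', hc'', hcc⟩ := h c hc
  have hdiff : KZ.eval (c - c'') = 0 := AddMonoidHom.mem_ker.1 (closure_gens_le_ker_eval hcc)
  have h0 : KZ.eval c'' = 0 := by
    rw [map_sub, hc, zero_sub, neg_eq_zero] at hdiff
    exact hdiff
  refine ⟨0, S.zero_mem, ?_⟩
  have : c - 0 = (c - c'') + c'' := by abel
  rw [this]
  exact AddSubgroup.add_mem _ hcc (hT c'' hc'' h0)

/-- **Plan B assembled (PROVED modulo HB2 and the residual)**: HB2 + `ReducesTo (closure hwMaxGens)` ⇒ the stub. -/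
theorem stubK_of_planB (hCell : CellKernel (AddSubgroup.closure hwMaxGens))
    (hRes : ReducesTo (AddSubgroup.closure hwMaxGens)) : StubK :=
  stubK_iff_reducesTo.mpr (reducesTo_of_reducesTo_of_cell _ _ hCell hRes)

/-- **The residual does not move (PROVED)**: given HB2, the perturbed remainder is STILL the summit
(`XMapKernelIffSummit.reduction_iff_summit_of_cell` for the bigger sector). -/
theorem planB_residual_iff_summit (hCell : CellKernel (AddSubgroup.closure hwMaxGens)) :
    ReducesTo (AddSubgroup.closure hwMaxGens) ↔ _root_.KontsevichZagierPeriods :=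
  Summit.KontsevichZagierPeriods.IsogenyCertificates.XMapKernelIffSummit.reduction_iff_summit_of_cell _ hCell

/-! ## PLAN C — extremal instances: the smallest kernel elements outside every linear cell -/

/-- **HC1 (M, one cycle — certificate)**: the `D = −4` Chowla–Selberg instance, the FIRST element of `ker eval`
that leaves the HW-maximal linear sector: `∫_{x³−x>0} dx/√(x³−x) = B(1/4, 1/2)` as a move chain — (1a) split at
the two components, rule (2) with `x = t^{-1/2}` on `(1,∞)` and `x = −t^{1/2}` on `(−1,0)` (each lands on
`[(0,1), ½ t^{-3/4}(1−t)^{-1/2}]`), (1b) to add the halves. Playbook: rule-(2) move witness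
(`TerasomaMultiplicationBetaCancellationStubAffineMove`). -/
theorem HC1_lemniscateBeta : ∀ (r s : KZ.IntegralRep 1),
    r.domain = {x | 0 < x 0 ^ 3 + (-1 : ℝ) * x 0 + (0 : ℝ)} →
    EqOn r.integrand (fun x => (1 : ℝ) / Real.sqrt (x 0 ^ 3 + (-1 : ℝ) * x 0 + (0 : ℝ))) r.domain →
    s.domain = {x | x 0 ∈ Ioo (0 : ℝ) 1} →
    EqOn s.integrand (fun x => (x 0) ^ ((1 / 4 : ℝ) - 1) * (1 - x 0) ^ ((1 / 2 : ℝ) - 1)) s.domain →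
    KZ.of r - KZ.of s ∈ KZ.relations := by
  sorry

/-- **HC1 as an instance of the stub (PROVED from HC1)**: for the kernel element `c = [r] − [s]` the stub's witness
is `c' = 0`; i.e. on this `c` the stub says exactly "HC1". (Uses `closure gens = relations`,
`XMapKernelIffSummit.closure_gens_eq_relations_holds`.) -/
theorem stub_instance_of_HC1 (r s : KZ.IntegralRep 1) (h : KZ.of r - KZ.of s ∈ KZ.relations) :
    ∃ c' ∈ AddSubgroup.closure realSectorGens, (KZ.of r - KZ.of s) - c' ∈ AddSubgroup.closure gens :=
  ⟨0, AddSubgroup.zero_mem _, by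
    rw [sub_zero, Summit.KontsevichZagierPeriods.IsogenyCertificates.XMapKernelIffSummit.closure_gens_eq_relations_holds]
    exact h⟩

end Summit.KontsevichZagierPeriods.KontsevichZagierPeriods.Cruxes.XMapKernel.StubIdeasK3

end
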